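import Literature.NumberTheory.Transcendental.KZDilationBakerSectorComplexRelations
import Literature.NumberTheory.Transcendental.KZDilationBakerSectorComplexLifts
import Literature.NumberTheory.Transcendental.SemialgebraicAlgebraicPoints
import HarnessLib

/-!
# The complex Baker sector of the dilation pencil, IV: the lift (all simple poles)

**Theorem** (`KZ.dilationBakerSectorComplex_lift`, unconditional). Let `ρ` be Nash on
`(a,b) ⊇ [0,1]`; let `p_k, q_k, γ_k, δ_k` be real algebraic (`1/α_k = p_k + iq_k` the inverse
poles, `c_k = γ_k + iδ_k` the residues) with `0 < 1 − p_k x ∨ q_k x ≠ 0` on `(a,b)` (the poles avoid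
`[a,b]`). The real one-variable integrand
  `g(x) = ρ'(x) + Σ_k (γ_k(−p_k + (p_k²+q_k²)x) + δ_k q_k)/((1 − p_k x)² + (q_k x)²)`
— the general Nash-exact-plus-simple-poles integrand on `ℙ¹` with REAL OR COMPLEX poles, e.g. every
`P/Q ∈ (ℚ̄ ∩ ℝ)(x)` regular on `[a,b]` after partial fractions — with vanishing cube period
`∫₀¹ g = 0` has a dilation function `v_g(ϖ) = ∫_{[0,1]¹} g(ϖz) dz` in `(ϖ − 1)·D'` with ONE Nash
kernel on a neighbourhood of `[0,1] × [0,1]`. Proof: `∫₀¹ g = (ρ(1) − ρ(0)) + Σ_k Re(c_k log w_k(1))`;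
Baker's theorem on the polar part (`polar_decomposition`, file II) kills `ρ(1) − ρ(0)` and
decomposes the polar integrand along exact relations into logarithmic parts and argument parts,
each lifted by file III (`exists_kernel_logPart`, `exists_kernel_argPart`); the exact part is
`(ϖ − 1)·dslope (dslope ρ 0) 1`; sum the kernels. This is the `𝔾ₐ × (Res 𝔾ₘ)`-case of the
dimension-one lifting mechanism for crux `DilationLiftAtOne` of route
`KontsevichZagierPeriods/LiftingCriteria`, and contains the route's day-one test
`g = 1/(1+x²) − 2x/(1+x⁴)` (`arctan ϖ − arctan ϖ²`).

Everything is proved; no `def`, no named fact.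

## References
* A. Baker, *Transcendental Number Theory* (1975), Thm. 2.1. [`Baker1975`]
* M. Kontsevich, D. Zagier, *Periods* (2001), §1.2. [`KontsevichZagier2001`]
-/

noncomputable section

open Set MeasureTheory Filter MvPolynomial Complex
open scoped BigOperators Topology Real
open Literature.ModelTheory.ExponentialFields

namespace Literature.NumberTheory.Transcendental

namespace KZ

open BakerSectorComplex DilationLogSector

/-- **The complex Baker sector of the glue holds unconditionally.** See the module docstring.
[cite: Baker1975, Theorem 2.1] -/
theorem dilationBakerSectorComplex_lift {a b : ℝ} (ha : a < 0) (hb : 1 < b) {ρ : ℝ → ℝ}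
    (hρs : IsSemialgebraicFunOn ℚ {t : Fin 1 → ℝ | t 0 ∈ Ioo a b} (fun t => ρ (t 0)))
    (hρa : ∀ x ∈ Ioo a b, AnalyticAt ℝ ρ x)
    {A : ℕ} {p q γ δ : Fin A → ℝ} (hp : ∀ k, IsAlgebraic ℚ (p k)) (hq : ∀ k, IsAlgebraic ℚ (q k))
    (hγ : ∀ k, IsAlgebraic ℚ (γ k)) (hδ : ∀ k, IsAlgebraic ℚ (δ k))
    (hslit : ∀ k, ∀ x ∈ Ioo a b, 0 < 1 - p k * x ∨ q k * x ≠ 0)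
    (hsum : (∫ z in Set.pi Set.univ (fun _ : Fin 1 => Icc (0:ℝ) 1),
      (deriv ρ (((1:ℝ) • z) 0) + ∑ k, (γ k * (-p k + (p k ^ 2 + q k ^ 2) * (((1:ℝ) • z) 0)) +
        δ k * q k) / ((1 - p k * (((1:ℝ) • z) 0)) ^ 2 + (q k * (((1:ℝ) • z) 0)) ^ 2))) = 0) :
    ∃ (K : (Fin 2 → ℝ) → ℝ) (V : Set (Fin 2 → ℝ)), IsOpen V ∧
      (∀ ϖ ∈ Icc (0:ℝ) 1, ∀ x ∈ Set.pi Set.univ (fun _ : Fin 1 => Icc (0:ℝ) 1),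
        Matrix.vecCons ϖ x ∈ V) ∧
      IsSemialgebraicFunOn ℚ V K ∧ AnalyticOnNhd ℝ K V ∧
      ∀ ϖ ∈ Icc (0:ℝ) 1,
        (∫ z in Set.pi Set.univ (fun _ : Fin 1 => Icc (0:ℝ) 1),
          (deriv ρ ((ϖ • z) 0) + ∑ k, (γ k * (-p k + (p k ^ 2 + q k ^ 2) * ((ϖ • z) 0)) +
            δ k * q k) / ((1 - p k * ((ϖ • z) 0)) ^ 2 + (q k * ((ϖ • z) 0)) ^ 2))) =
          (ϖ - 1) * ∫ y in Set.pi Set.univ (fun _ : Fin 1 => Icc (0:ℝ) 1),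
            K (Matrix.vecCons ϖ (ϖ • y)) := by
  classical
  have hb0 : (0:ℝ) < b := zero_lt_one.trans hb
  have h0I : (0:ℝ) ∈ Ioo a b := ⟨ha, hb0⟩
  have h1I : (1:ℝ) ∈ Ioo a b := ⟨ha.trans zero_lt_one, hb⟩
  have hsub : Icc (0:ℝ) 1 ⊆ Ioo a b := fun x hx => ⟨ha.trans_le hx.1, hx.2.trans_lt hb⟩
  have hI : IsSemialgebraic ℚ {t : Fin 1 → ℝ | t 0 ∈ Ioo a b} :=
    IsSemialgebraicFunOn.isSemialgebraic_holds hρs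
  have hdil : ∀ {ϖ : ℝ}, ϖ ∈ Icc (0:ℝ) 1 → ∀ z ∈ Set.pi Set.univ (fun _ : Fin 1 => Icc (0:ℝ) 1),
      (ϖ • z) 0 ∈ Ioo a b := by
    intro ϖ hϖ z hz
    have hz0 : z 0 ∈ Icc (0:ℝ) 1 := (Set.mem_univ_pi.mp hz) 0
    refine hsub ⟨?_, ?_⟩
    · simpa using mul_nonneg hϖ.1 hz0.1
    · simpa using mul_le_one₀ hϖ.2 hz0.1 hz0.2
  -- the exact part `ρ`
  have hρd : ∀ x ∈ Ioo a b, HasDerivAt ρ (deriv ρ x) x := fun x hx =>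
    (hρa x hx).differentiableAt.hasDerivAt
  have hρ'c : ContinuousOn (deriv ρ) (Ioo a b) := fun x hx =>
    (hρa x hx).deriv.continuousAt.continuousWithinAt
  -- the polar part `σ` and its primitive `Λ = Re Σ_k c_k log w_k`
  set σ : ℝ → ℝ := fun x => ∑ k, (γ k * (-p k + (p k ^ 2 + q k ^ 2) * x) + δ k * q k) /
    ((1 - p k * x) ^ 2 + (q k * x) ^ 2) with hσ_def
  set Λ : ℝ → ℝ := fun x => (∑ k, ((γ k : ℂ) + (δ k : ℂ) * I) *
    Complex.log ((1 : ℂ) - ((p k : ℂ) + (q k : ℂ) * I) * (x : ℂ))).re with hΛ_def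
  have hΛd : ∀ x ∈ Ioo a b, HasDerivAt Λ (σ x) x := by
    intro x hx
    have h1 := HasDerivAt.fun_sum (u := Finset.univ) fun k _ =>
      (hasDerivAt_log_w (hslit k x hx)).const_mul ((γ k : ℂ) + (δ k : ℂ) * I)
    have h2 := Complex.reCLM.hasFDerivAt.comp_hasDerivAt x h1
    have hσx : σ x = Complex.reCLM (∑ k, ((γ k : ℂ) + (δ k : ℂ) * I) *
        (-((p k : ℂ) + (q k : ℂ) * I) / ((1 : ℂ) - ((p k : ℂ) + (q k : ℂ) * I) * (x : ℂ)))) := by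
      rw [Complex.reCLM_apply, Complex.re_sum]
      exact Finset.sum_congr rfl fun k _ => (re_residue_term (γ k) (δ k) (hslit k x hx)).symm
    rw [hσx]
    exact h2
  have hpole : ∀ k, ∀ x ∈ Ioo a b, (1 - p k * x) ^ 2 + (q k * x) ^ 2 ≠ 0 :=
    fun k x hx => (m_pos (hslit k x hx)).ne'
  have hσc : ContinuousOn σ (Ioo a b) := by
    refine continuousOn_finsetSum _ fun k _ => ?_
    refine ContinuousOn.div (by fun_prop) (by fun_prop) (hpole k)
  -- the numerical relation at `ϖ = 1`
  have hΛ0 : Λ 0 = 0 := by simp [hΛ_def]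
  have hnum : (ρ 1 - ρ 0) + (∑ k, (((γ k : ℂ) + (δ k : ℂ) * I) *
      Complex.log ((1 : ℂ) - ((p k : ℂ) + (q k : ℂ) * I) * ((1:ℝ) : ℂ)))).re = 0 := by
    have hone : (1:ℝ) ∈ Ioc (0:ℝ) 1 := ⟨zero_lt_one, le_rfl⟩
    have hi1 := integrableOn_dilate_one ha hb hρ'c ⟨zero_le_one, le_rfl⟩ (F := deriv ρ)
    have hi2 := integrableOn_dilate_one ha hb hσc ⟨zero_le_one, le_rfl⟩ (F := σ)
    have hsplit := integral_add hi1 hi2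
    have hA : (∫ z in Set.pi Set.univ (fun _ : Fin 1 => Icc (0:ℝ) 1), deriv ρ (((1:ℝ) • z) 0)) =
        ρ 1 - ρ 0 := by
      rw [dilation_integral_deriv ha hb hρa ⟨zero_le_one, le_rfl⟩, dslope_of_ne _ one_ne_zero,
        slope_def_field]
      simp
    have hB : (∫ z in Set.pi Set.univ (fun _ : Fin 1 => Icc (0:ℝ) 1), σ (((1:ℝ) • z) 0)) =
        Λ 1 - Λ 0 := by
      rw [dilation_integral_of_hasDerivAt ha hb hΛd hσc hone, div_one]
    rw [hΛ0, sub_zero] at hB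
    have : Λ 1 = (∑ k, (((γ k : ℂ) + (δ k : ℂ) * I) *
        Complex.log ((1 : ℂ) - ((p k : ℂ) + (q k : ℂ) * I) * ((1:ℝ) : ℂ)))).re := rfl
    rw [← this, ← hA, ← hB, ← hsplit]
    simpa only [hσ_def] using hsum
  -- BAKER on the polar part
  have hralg : IsAlgebraic ℚ (ρ 1 - ρ 0) :=
    (hρs.isAlgebraic_apply_one h1I isAlgebraic_one).sub (hρs.isAlgebraic_apply_one h0I isAlgebraic_zero)
  rw [Complex.re_sum] at hnum
  obtain ⟨hr0, aR, aI, e, f, haR, haI, hErel, hFrel, hdecomp⟩ :=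
    polar_decomposition hp hq hγ hδ (fun k => hslit k 1 h1I) hralg hnum
  -- the lifts of the logarithmic and argument parts, for every `j`
  choose KL VL hVLo hVLc hKLs hKLa hLid using fun j =>
    exists_kernel_logPart ha hb hI hp hq hslit (e j) (hErel j)
  choose KA VA hVAo hVAc hKAs hKAa hAid using fun j =>
    exists_kernel_argPart ha hb hI hp hq hslit (f j) (hFrel j)
  -- the exact part: `v_{ρ'} = dslope ρ 0 = (ϖ − 1) τ`
  set τ : ℝ → ℝ := dslope (dslope ρ 0) 1 with hτ_def
  have hds1 : dslope ρ 0 1 = 0 := by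
    rw [dslope_of_ne _ one_ne_zero, slope_def_field, sub_zero, div_one]; exact hr0
  have hτeq : ∀ ϖ, dslope ρ 0 ϖ = (ϖ - 1) * τ ϖ := fun ϖ => by
    have h := sub_smul_dslope (dslope ρ 0) 1 ϖ
    rw [hds1, sub_zero, smul_eq_mul] at h
    exact h.symm
  have hσ0s : IsSemialgebraicFunOn ℚ {t : Fin 1 → ℝ | t 0 ∈ Ioo a b} (fun t => dslope ρ 0 (t 0)) := by
    have h := IsSemialgebraicFunOn.dslope_ratCast (f' := deriv ρ) 0 (by simpa using h0I) hρs hρd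
    simpa using h
  have hσ0a : ∀ x ∈ Ioo a b, AnalyticAt ℝ (dslope ρ 0) x := fun x hx =>
    analyticAt_dslope_of_analyticAt (hρa 0 h0I) (hρa x hx)
  have hτs : IsSemialgebraicFunOn ℚ {t : Fin 1 → ℝ | t 0 ∈ Ioo a b} (fun t => τ (t 0)) := by
    have h := IsSemialgebraicFunOn.dslope_ratCast (f' := deriv (dslope ρ 0)) 1 (by simpa using h1I)
      hσ0s (fun x hx => (hσ0a x hx).differentiableAt.hasDerivAt)
    simpa using h
  have hτa : ∀ x ∈ Ioo a b, AnalyticAt ℝ τ x := fun x hx =>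
    analyticAt_dslope_of_analyticAt (hσ0a 1 h1I) (hσ0a x hx)
  -- the total kernel
  set Vt : Set (Fin 2 → ℝ) := {p : Fin 2 → ℝ | p 0 ∈ Ioo a b} ∩ ((⋂ j, VL j) ∩ ⋂ j, VA j) with hVt
  set Kt : (Fin 2 → ℝ) → ℝ := fun pt => τ (pt 0) + ∑ j, (aR j * KL j pt - aI j * KA j pt) with hKt
  have hVtI : IsSemialgebraic ℚ {p : Fin 2 → ℝ | p 0 ∈ Ioo a b} := by
    simpa using hI.preimage_comp (fun _ : Fin 1 => (0 : Fin 2))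
  -- finite intersections of semialgebraic sets (inline)
  have hiInter : ∀ {V : (Fin A ⊕ Fin A) → Set (Fin 2 → ℝ)}, (∀ j, IsSemialgebraic ℚ (V j)) →
      IsSemialgebraic ℚ (⋂ j, V j) := by
    intro V hV
    have key : ∀ s : Finset (Fin A ⊕ Fin A), IsSemialgebraic ℚ (⋂ j ∈ s, V j) := by
      intro s
      induction s using Finset.induction_on with
      | empty => simp
      | insert j s hj ih =>
        rw [Finset.set_biInter_insert]
        exact (hV j).inter ih
    simpa using key Finset.univ
  have hVts : IsSemialgebraic ℚ Vt :=
    hVtI.inter ((hiInter fun j => IsSemialgebraicFunOn.isSemialgebraic_holds (hKLs j)).inter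
      (hiInter fun j => IsSemialgebraicFunOn.isSemialgebraic_holds (hKAs j)))
  have hVtL : ∀ j, Vt ⊆ VL j := fun j x hx => mem_iInter.mp hx.2.1 j
  have hVtA : ∀ j, Vt ⊆ VA j := fun j x hx => mem_iInter.mp hx.2.2 j
  refine ⟨Kt, Vt, ?_, ?_, ?_, ?_, ?_⟩
  · -- open
    exact (isOpen_Ioo.preimage (continuous_apply 0)).inter
      ((isOpen_iInter_of_finite fun j => hVLo j).inter (isOpen_iInter_of_finite fun j => hVAo j))
  · -- contains `[0,1] × [0,1]`
    intro ϖ hϖ x hx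
    exact ⟨by simpa using hsub hϖ, mem_iInter.mpr fun j => hVLc j ϖ hϖ x hx,
      mem_iInter.mpr fun j => hVAc j ϖ hϖ x hx⟩
  · -- semialgebraic
    have hproj : IsSemialgebraicMapOn ℚ Vt (fun p : Fin 2 → ℝ => fun _ : Fin 1 => p 0) :=
      IsSemialgebraicMapOn.of_forall hVts fun _ => by
        simpa using isSemialgebraicFunOn_aeval hVts (X 0 : MvPolynomial (Fin 2) ℚ)
    have hmaps : MapsTo (fun p : Fin 2 → ℝ => fun _ : Fin 1 => p 0) Vt
        {t : Fin 1 → ℝ | t 0 ∈ Ioo a b} := fun p hp => hp.1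
    have hτV : IsSemialgebraicFunOn ℚ Vt (fun p => τ (p 0)) :=
      (IsSemialgebraicFunOn.comp_isSemialgebraicMapOn_holds hτs hproj hmaps).congr fun _ _ => rfl
    have hsumV : IsSemialgebraicFunOn ℚ Vt (fun p => ∑ j, (aR j * KL j p - aI j * KA j p)) :=
      IsSemialgebraicFunOn.fun_finsetSum Finset.univ hVts fun j _ =>
        ((isSemialgebraicFunOn_const_of_isAlgebraic hVts (haR j)).fun_mul
          ((hKLs j).mono (hVtL j) hVts)).fun_sub
        ((isSemialgebraicFunOn_const_of_isAlgebraic hVts (haI j)).fun_mul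
          ((hKAs j).mono (hVtA j) hVts))
    exact hτV.fun_add hsumV
  · -- analytic
    intro pt hpt
    have h0 : AnalyticAt ℝ (fun p : Fin 2 → ℝ => p 0) pt :=
      (ContinuousLinearMap.proj (R := ℝ) (φ := fun _ : Fin 2 => ℝ) 0).analyticAt pt
    have hτp : AnalyticAt ℝ (fun p : Fin 2 → ℝ => τ (p 0)) pt :=
      AnalyticAt.comp (f := fun q : Fin 2 → ℝ => q 0) (hτa (pt 0) hpt.1) h0
    refine hτp.add ?_
    exact Finset.analyticAt_fun_sum _ fun j _ =>
      (analyticAt_const.mul (hKLa j pt (hVtL j hpt))).sub (analyticAt_const.mul (hKAa j pt (hVtA j hpt)))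
  · -- the identity on `[0,1]`
    intro ϖ hϖ
    -- the logarithmic and argument integrands
    set hL : (Fin A ⊕ Fin A) → ℝ → ℝ := fun j x => ∑ k, (e j k : ℝ) *
      ((-p k + (p k ^ 2 + q k ^ 2) * x) / ((1 - p k * x) ^ 2 + (q k * x) ^ 2)) with hhL
    set ψ : (Fin A ⊕ Fin A) → ℝ → ℝ := fun j x => ∑ k, (f j k : ℝ) *
      (-q k / ((1 - p k * x) ^ 2 + (q k * x) ^ 2)) with hψ
    have hLc : ∀ j, ContinuousOn (hL j) (Ioo a b) := fun j => by
      refine continuousOn_finsetSum _ fun k _ => continuousOn_const.mul ?_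
      exact ContinuousOn.div (by fun_prop) (by fun_prop) (hpole k)
    have hψc : ∀ j, ContinuousOn (ψ j) (Ioo a b) := fun j => by
      refine continuousOn_finsetSum _ fun k _ => continuousOn_const.mul ?_
      exact ContinuousOn.div (by fun_prop) (by fun_prop) (hpole k)
    -- integrability on the cube
    have hi1 : IntegrableOn (fun z : Fin 1 → ℝ => deriv ρ ((ϖ • z) 0))
        (Set.pi Set.univ (fun _ : Fin 1 => Icc (0:ℝ) 1)) volume :=
      integrableOn_dilate_one ha hb hρ'c hϖ
    have hiL : ∀ j, IntegrableOn (fun z : Fin 1 → ℝ => aR j * hL j ((ϖ • z) 0))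
        (Set.pi Set.univ (fun _ : Fin 1 => Icc (0:ℝ) 1)) volume := fun j =>
      (integrableOn_dilate_one ha hb (hLc j) hϖ).const_mul (aR j)
    have hiA : ∀ j, IntegrableOn (fun z : Fin 1 → ℝ => aI j * ψ j ((ϖ • z) 0))
        (Set.pi Set.univ (fun _ : Fin 1 => Icc (0:ℝ) 1)) volume := fun j =>
      (integrableOn_dilate_one ha hb (hψc j) hϖ).const_mul (aI j)
    have hiLA : ∀ j, IntegrableOn (fun z : Fin 1 → ℝ => aR j * hL j ((ϖ • z) 0) - aI j * ψ j ((ϖ • z) 0))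
        (Set.pi Set.univ (fun _ : Fin 1 => Icc (0:ℝ) 1)) volume := fun j => (hiL j).sub (hiA j)
    have hi2 : IntegrableOn (fun z : Fin 1 → ℝ => ∑ j, (aR j * hL j ((ϖ • z) 0) - aI j * ψ j ((ϖ • z) 0)))
        (Set.pi Set.univ (fun _ : Fin 1 => Icc (0:ℝ) 1)) volume :=
      integrable_finsetSum _ fun j _ => hiLA j
    -- the polar integrand equals its decomposition on the cube
    have hσ_split : (∫ z in Set.pi Set.univ (fun _ : Fin 1 => Icc (0:ℝ) 1), σ ((ϖ • z) 0)) =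
        ∫ z in Set.pi Set.univ (fun _ : Fin 1 => Icc (0:ℝ) 1),
          ∑ j, (aR j * hL j ((ϖ • z) 0) - aI j * ψ j ((ϖ • z) 0)) := by
      refine setIntegral_congr_fun (MeasurableSet.univ_pi fun _ => measurableSet_Icc) fun z hz => ?_
      have hy := hdil hϖ z hz
      simp only [hσ_def, hhL, hψ]
      exact hdecomp _ (fun k => hslit k _ hy)
    -- left-hand side
    have hL : (∫ z in Set.pi Set.univ (fun _ : Fin 1 => Icc (0:ℝ) 1),
          (deriv ρ ((ϖ • z) 0) + ∑ k, (γ k * (-p k + (p k ^ 2 + q k ^ 2) * ((ϖ • z) 0)) +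
            δ k * q k) / ((1 - p k * ((ϖ • z) 0)) ^ 2 + (q k * ((ϖ • z) 0)) ^ 2))) =
        (ϖ - 1) * τ ϖ + ∑ j, (aR j * ((ϖ - 1) *
            ∫ y in Set.pi Set.univ (fun _ : Fin 1 => Icc (0:ℝ) 1), KL j (Matrix.vecCons ϖ (ϖ • y))) -
          aI j * ((ϖ - 1) *
            ∫ y in Set.pi Set.univ (fun _ : Fin 1 => Icc (0:ℝ) 1), KA j (Matrix.vecCons ϖ (ϖ • y)))) := by
      have hfun : (fun z : Fin 1 → ℝ => deriv ρ ((ϖ • z) 0) + ∑ k, (γ k * (-p k + (p k ^ 2 + q k ^ 2) *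
          ((ϖ • z) 0)) + δ k * q k) / ((1 - p k * ((ϖ • z) 0)) ^ 2 + (q k * ((ϖ • z) 0)) ^ 2)) =
          fun z => deriv ρ ((ϖ • z) 0) + σ ((ϖ • z) 0) := by
        funext z; simp only [hσ_def]
      have hi2' : IntegrableOn (fun z : Fin 1 → ℝ => σ ((ϖ • z) 0))
          (Set.pi Set.univ (fun _ : Fin 1 => Icc (0:ℝ) 1)) volume :=
        integrableOn_dilate_one ha hb hσc hϖ
      rw [hfun, integral_add hi1 hi2', dilation_integral_deriv ha hb hρa hϖ, hτeq, hσ_split,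
        integral_finsetSum _ fun j _ => hiLA j]
      congr 1
      refine Finset.sum_congr rfl fun j _ => ?_
      rw [integral_sub (hiL j) (hiA j), integral_const_mul, integral_const_mul]
      simp only [hhL, hψ]
      rw [hLid j ϖ hϖ, hAid j ϖ hϖ]
    -- right-hand side
    have hk0 : ∀ y : Fin 1 → ℝ, (Matrix.vecCons ϖ (ϖ • y) : Fin 2 → ℝ) 0 = ϖ := fun y => by simp
    have htwist : ∀ {K : (Fin 2 → ℝ) → ℝ} {V : Set (Fin 2 → ℝ)},
        (∀ ϖ ∈ Icc (0:ℝ) 1, ∀ x ∈ Set.pi Set.univ (fun _ : Fin 1 => Icc (0:ℝ) 1),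
          Matrix.vecCons ϖ x ∈ V) → AnalyticOnNhd ℝ K V →
        IntegrableOn (fun y : Fin 1 → ℝ => K (Matrix.vecCons ϖ (ϖ • y)))
          (Set.pi Set.univ (fun _ : Fin 1 => Icc (0:ℝ) 1)) volume := by
      intro K V hVc hKa
      refine ContinuousOn.integrableOn_compact (isCompact_univ_pi fun _ => isCompact_Icc) ?_
      have hpath : Continuous fun y : Fin 1 → ℝ => Matrix.vecCons ϖ (ϖ • y) :=
        continuous_const.matrixVecCons (continuous_const_smul ϖ)
      refine hKa.continuousOn.comp hpath.continuousOn fun y hy => hVc ϖ hϖ _ ?_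
      rw [Set.mem_univ_pi] at hy ⊢
      intro i
      exact ⟨mul_nonneg hϖ.1 (hy i).1, mul_le_one₀ hϖ.2 (hy i).1 (hy i).2⟩
    have hkL : ∀ j, IntegrableOn (fun y : Fin 1 → ℝ => aR j * KL j (Matrix.vecCons ϖ (ϖ • y)))
        (Set.pi Set.univ (fun _ : Fin 1 => Icc (0:ℝ) 1)) volume := fun j =>
      (htwist (hVLc j) (hKLa j)).const_mul (aR j)
    have hkA : ∀ j, IntegrableOn (fun y : Fin 1 → ℝ => aI j * KA j (Matrix.vecCons ϖ (ϖ • y)))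
        (Set.pi Set.univ (fun _ : Fin 1 => Icc (0:ℝ) 1)) volume := fun j =>
      (htwist (hVAc j) (hKAa j)).const_mul (aI j)
    have hkLA : ∀ j, IntegrableOn (fun y : Fin 1 → ℝ =>
        aR j * KL j (Matrix.vecCons ϖ (ϖ • y)) - aI j * KA j (Matrix.vecCons ϖ (ϖ • y)))
        (Set.pi Set.univ (fun _ : Fin 1 => Icc (0:ℝ) 1)) volume := fun j => (hkL j).sub (hkA j)
    have hk1 : IntegrableOn (fun y : Fin 1 → ℝ => τ ((Matrix.vecCons ϖ (ϖ • y) : Fin 2 → ℝ) 0))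
        (Set.pi Set.univ (fun _ : Fin 1 => Icc (0:ℝ) 1)) volume := by
      simp only [hk0]
      exact integrableOn_const (hs :=
        ne_of_lt (IsCompact.measure_lt_top (isCompact_univ_pi fun _ => isCompact_Icc)))
    have hk2 : IntegrableOn (fun y : Fin 1 → ℝ => ∑ j,
        (aR j * KL j (Matrix.vecCons ϖ (ϖ • y)) - aI j * KA j (Matrix.vecCons ϖ (ϖ • y))))
        (Set.pi Set.univ (fun _ : Fin 1 => Icc (0:ℝ) 1)) volume :=
      integrable_finsetSum _ fun j _ => hkLA j
    have hR : (∫ y in Set.pi Set.univ (fun _ : Fin 1 => Icc (0:ℝ) 1), Kt (Matrix.vecCons ϖ (ϖ • y))) =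
        τ ϖ + ∑ j, (aR j *
            (∫ y in Set.pi Set.univ (fun _ : Fin 1 => Icc (0:ℝ) 1), KL j (Matrix.vecCons ϖ (ϖ • y))) -
          aI j * (∫ y in Set.pi Set.univ (fun _ : Fin 1 => Icc (0:ℝ) 1), KA j (Matrix.vecCons ϖ (ϖ • y)))) := by
      simp only [hKt]
      rw [integral_add hk1 hk2, integral_finsetSum _ fun j _ => hkLA j]
      simp only [hk0, setIntegral_cube_one_const]
      congr 1
      refine Finset.sum_congr rfl fun j _ => ?_
      rw [integral_sub (hkL j) (hkA j), integral_const_mul, integral_const_mul]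
    rw [hL, hR, mul_add, Finset.mul_sum]
    congr 1
    exact Finset.sum_congr rfl fun j _ => by ring

end KZ

end Literature.NumberTheory.Transcendental
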